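import Summits.QuantumFields.YangMills.Theorems.PoincareLipschitzHierAlignStepFactor
import Summits.QuantumFields.YangMills.Theorems.PoincareLipschitzHierAlignMultilinear
import Summits.QuantumFields.YangMills.Theorems.PoincareLipschitzHierAlignCell
import Summits.QuantumFields.YangMills.Theorems.PoincareLipschitzHierAlignCornerData
import Summits.QuantumFields.YangMills.Theorems.PoincareLipschitzHierAlignSharpStepLetters
import HarnessLib

/-!
# Crux stmt-QuantumFields-19936 `HistoryTailL` — S-ALIGN (S1): THE SHARP ONE-STEP GAUGE
# in the smoothed rooted gauge `ũ = exp(Φ)·u₀` EVERY fine link is within `X∕L + O(w) + O((d(X+w))²) + O(L²a)` of `1` — first order `X∕L`, not `X`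

Cell `ym3-torus` (rung R3 = YM₃ on T³ — a RUNG, NOT the Clay problem), width seat `ym-ust-19936-w3` gen 12, `--supports stmt-QuantumFields-19936 --as helper`.
Summons w2 g11 02:42:44Z «w3 g12: S-ALIGN» (the hierarchical chart with geometric decay below the top, for ✓`PoincareLipschitzMassRowsOfLowCharts`).
✓`PoincareLipschitzHierAlignStepFactor` puts the fine field, block by block, in the rooted comb gauge `u₀` (`u₀ ∘ emb = h`): interior links within
`f = ((d+2)L)²a∕4` of `1`, face links `= E_b·G_c` with `G = (Ū V)^h` the gauged block average and `dist1 E_b ≤ 7f` — so the whole coarse deviation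
`X ≥ dist1 G_c` sits on ONE fine link per face.  THIS FILE smooths it: with per-root coarse gauges `κ_y` in which `G` has `w`-small links on the unit
cube around `y` (hypothesis; an axial gauge of the coarse plaquettes supplies them), the rooted potentials `U_y(z) = κ_y(y)⁻¹κ_y(z)` and their guarded
logarithms, `Φ(x) := −Σ_ε W_ε(t(x))·glog U_{blockOf x}(z₀(x)+ε)` is the MULTILINEAR interpolation over the coarse cell of `x` (✓`…Multilinear`,
✓`…Cell`) of the corner data rooted at `x`'s own block (✓`…CornerData`), `Φ ∈ 𝔰𝔲` so `E = exp Φ ∈ SU` (✓`…ExpToolkit`), `Φ ∘ emb = 0`, and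
★★★ `exists_smoothGauge`: `ũ := E·u₀` is rooted (`ũ ∘ emb = h`) and for every fine bond `b` whose block is in `S`,
`dist1 ((V^ũ) b) ≤ X∕L + 240·((d+1)(X+w))² + (4d+3)·w + 7f` (interior links: the interpolant moves by `≤ (X + O(w) + O(Y²))∕L` per fine step,
✓`…SharpLemmas` interior product; face links: the change of root cancels `G_c` to first order, ✓`…CornerData.norm_glog_corner_root_change_le`,
✓`…SharpLemmas` face product; cross-cell steps are EXACT by ✓`…Cell.interp_face_shift`).  Smallness: `8(d+1)(X+w) ≤ 1∕10`, `f < deltaSU`, `N ≤ 9`.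
-/

noncomputable section

open scoped BigOperators Matrix.Norms.L2Operator
open NormedSpace

namespace Summit.QuantumFields.YangMills.Theorems.PoincareLipschitzHierAlignSharpStep

open Literature.MathematicalPhysics.QuantumFieldTheory.Balaban1983to89
open Literature.MathematicalPhysics.QuantumFieldTheory.Balaban1983to89.MatrixLog (mlog)
open T4Continuum BlockAveraging ExpMeanLog
open Summit.QuantumFields.YangMills.Theorems.PoincareLipschitzHierAlignStepFactor (exists_rootedBlockAxialGauge_factor_SU)
open Summit.QuantumFields.YangMills.Theorems.PoincareLipschitzHierAlignMultilinear (sum_weights_eq_one weights_nonneg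
  norm_interp_succ_sub_interp_le)
open Summit.QuantumFields.YangMills.Theorems.PoincareLipschitzHierAlignCell
open Summit.QuantumFields.YangMills.Theorems.PoincareLipschitzHierAlignExpToolkit (exp_mem_specialUnitaryGroup coe_inv_mk_exp coe_mul
  star_ite_mlog_eq_neg trace_ite_mlog_eq_zero)
open Summit.QuantumFields.YangMills.Theorems.PoincareLipschitzHierAlignSharpLemmas
open Summit.QuantumFields.YangMills.Theorems.PoincareLipschitzHierAlignCornerData
open Summit.QuantumFields.YangMills.Theorems.PoincareLipschitzHierAlignSharpStepLetters

/-! ## The sharp one-step gauge -/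

section Main

variable {P : Params} {j : ℕ} {n : Type*} [Fintype n] [DecidableEq n] [Nonempty n]

/-- ★★★ **THE SHARP ONE-STEP GAUGE.**  Fine level `j`, coarse level `j+1` (standing range), `SU(N)` with `N ≤ 9`.  Data: the fine field `V`,
a coarse gauge `h`, per-root coarse gauges `κ y`, a set `S` of blocks; `G := (Ū V)^h`.  Hypotheses: on the unit cube around every coarse
site `y` within a unit cube of `S`, `G` is `X`-small and `G^{κ y}` is `w`-small; the fine plaquettes within `2d` blocks of `S` are `< a`;
`8(d+1)(X+w) ≤ 1∕10`; `((d+2)L)²a∕4 < deltaSU`.  Conclusion: a fine gauge `ũ` with `ũ ∘ emb = h` and, on every fine bond `b` with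
`blockOf b₋ ∈ S`, `dist1 ((V^ũ) b) ≤ X∕L + 240((d+1)(X+w))² + (4d+3)w + 7·((d+2)L)²a∕4`. [folklore] -/
theorem exists_smoothGauge (hn : Fintype.card n ≤ 9) (hj : j + 1 ≤ P.m + P.K) (hL3 : 3 ≤ P.L)
    (V : GaugeField P j (Matrix.specialUnitaryGroup n ℂ)) (h : GaugeTransf P (j + 1) (Matrix.specialUnitaryGroup n ℂ))
    (κ : Site P (j + 1) → GaugeTransf P (j + 1) (Matrix.specialUnitaryGroup n ℂ)) (S : Set (Site P (j + 1))) {X w a : ℝ}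
    (hX0 : 0 ≤ X) (hw0 : 0 ≤ w) (ha0 : 0 ≤ a) (hsmall : 8 * ((P.d : ℝ) + 1) * (X + w) ≤ 1 / 10)
    (hguard : ((((P.d + 2) * P.L : ℕ) : ℝ) ^ 2 / 4) * a < deltaSU n)
    (hcoarse : ∀ y : Site P (j + 1),
      (∃ s ∈ S, ∀ i, ∃ e : ℤ, -1 ≤ e ∧ e ≤ 1 ∧ y i = s i + ((e : ℤ) : ZMod (P.sitesPerDir (j + 1)))) →
      ∀ c : PBond P (j + 1),
        (∀ i, ∃ e : ℤ, -1 ≤ e ∧ e ≤ 1 ∧ c.src i = y i + ((e : ℤ) : ZMod (P.sitesPerDir (j + 1)))) →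
        (∀ i, ∃ e : ℤ, -1 ≤ e ∧ e ≤ 1 ∧ c.tgt i = y i + ((e : ℤ) : ZMod (P.sitesPerDir (j + 1)))) →
          dist1 (GaugeField.gaugeAct h (avgFun (expMeanLogSU (n := n)) V) c) ≤ X ∧
          dist1 (GaugeField.gaugeAct (κ y) (GaugeField.gaugeAct h (avgFun (expMeanLogSU (n := n)) V)) c) ≤ w)
    (hplaq : ∀ b : PBond P j, blockOf b.src ∈ S →
      ∀ q : Plaq P j, Site.tdist (blockOf q.src) (blockOf b.src) ≤ 2 * P.d → dist1 (GaugeField.plaqHol V q) < a) :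
    ∃ ũ : GaugeTransf P j (Matrix.specialUnitaryGroup n ℂ), (∀ y, ũ (emb y) = h y) ∧
      ∀ b : PBond P j, blockOf b.src ∈ S →
        dist1 (GaugeField.gaugeAct ũ V b) ≤
          X / P.L + 240 * (((P.d : ℝ) + 1) * (X + w)) ^ 2 + (4 * P.d + 3) * w + 7 * (((((P.d + 2) * P.L : ℕ) : ℝ) ^ 2 / 4) * a) := by
  classical
  obtain ⟨u₀, hroot₀, hb₀⟩ := exists_rootedBlockAxialGauge_factor_SU (n := n) hj V h
  -- constants
  set G : GaugeField P (j + 1) (Matrix.specialUnitaryGroup n ℂ) := GaugeField.gaugeAct h (avgFun (expMeanLogSU (n := n)) V) with hG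
  set f : ℝ := ((((P.d + 2) * P.L : ℕ) : ℝ) ^ 2 / 4) * a with hf
  have hf0 : 0 ≤ f := by rw [hf]; positivity
  set hh : ℕ := (P.L - 1) / 2 with hhh
  have h2h : 2 * hh + 1 = P.L := by rw [hhh]; exact two_mul_half_add_one
  have hL0 : 0 < P.L := P.L_pos
  have hLr : (1 : ℝ) ≤ P.L := by exact_mod_cast hL0
  have hd1 : (1 : ℝ) ≤ P.d := by exact_mod_cast P.hd
  set Y : ℝ := P.d * (X + w) with hY
  have hY80 : Y ≤ 1 / 80 := by rw [hY]; nlinarith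
  have hα : 2 * Y ≤ 1 / 4 := by linarith
  have hXwY : X + w ≤ Y := by rw [hY]; nlinarith
  -- the objects
  let sft : Site P j → Site P j := fun x i => x i - ((hh : ℕ) : ZMod (P.sitesPerDir j))
  let tt : Site P j → Fin P.d → ℕ := fun x k => (sft x k).val % P.L
  let z0 : Site P j → Site P (j + 1) := fun x => blockOf (sft x)
  let cor : Site P (j + 1) → (Fin P.d → Bool) → Site P (j + 1) := fun z ε i => z i + (if ε i then 1 else 0)
  let Up : Site P (j + 1) → Site P (j + 1) → Matrix.specialUnitaryGroup n ℂ := fun y z => (κ y y)⁻¹ * κ y z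
  let gl : Matrix.specialUnitaryGroup n ℂ → Matrix n n ℂ := fun g =>
    if ‖(g : Matrix n n ℂ) - 1‖ < 1 / 3 then mlog (g : Matrix n n ℂ) else 0
  let Λ : Site P j → (Fin P.d → Bool) → Matrix n n ℂ := fun x ε => gl (Up (blockOf x) (cor (z0 x) ε))
  let W : (Fin P.d → ℕ) → (Fin P.d → Bool) → ℝ := fun t ε =>
    ∏ k, (if ε k then ((t k : ℝ) / P.L) else (1 - (t k : ℝ) / P.L))
  let Φ : Site P j → Matrix n n ℂ := fun x => -∑ ε : Fin P.d → Bool, W (tt x) ε • Λ x ε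
  -- `Φ ∈ 𝔰𝔲`
  have hgl_skew : ∀ g : Matrix.specialUnitaryGroup n ℂ, star (gl g) = -gl g := fun g => star_ite_mlog_eq_neg g
  have hgl_tr : ∀ g : Matrix.specialUnitaryGroup n ℂ, (gl g).trace = 0 := fun g => trace_ite_mlog_eq_zero hn g
  have hskew : ∀ x, star (Φ x) = -Φ x := fun x => by
    show star (-∑ ε : Fin P.d → Bool, W (tt x) ε • Λ x ε) = -(-∑ ε : Fin P.d → Bool, W (tt x) ε • Λ x ε)
    rw [star_neg, star_sum_real_smul _ _ _ (fun ε _ => hgl_skew _)]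
  have htr : ∀ x, (Φ x).trace = 0 := fun x => by
    show (-∑ ε : Fin P.d → Bool, W (tt x) ε • Λ x ε).trace = 0
    rw [Matrix.trace_neg, trace_sum_real_smul _ _ _ (fun ε _ => hgl_tr _), neg_zero]
  let E : Site P j → Matrix.specialUnitaryGroup n ℂ := fun x => ⟨exp (Φ x), exp_mem_specialUnitaryGroup (hskew x) (htr x)⟩
  -- general cell facts
  have htt_lt : ∀ x k, tt x k < P.L := fun x k => Nat.mod_lt _ hL0
  have htt_le : ∀ x k, tt x k ≤ P.L := fun x k => (htt_lt x k).le
  have hxs : ∀ x : Site P j, (fun i => sft x i + ((hh : ℕ) : ZMod (P.sitesPerDir j))) = x := fun x => sub_const_add x _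
  have hblk : ∀ (x : Site P j) (k : Fin P.d), blockOf x k = z0 x k + (if hh + 1 ≤ tt x k then 1 else 0) := fun x k => by
    have := blockOf_add_half_eq hj (sft x) k
    rw [hxs x] at this
    exact this
  have hblk' : ∀ x : Site P j, blockOf x = cor (z0 x) (fun k => decide (hh + 1 ≤ tt x k)) := fun x => by
    funext k; rw [hblk x k]; simp [cor]
  -- the weights
  have hWnn : ∀ (x : Site P j) (ε : Fin P.d → Bool), 0 ≤ W (tt x) ε := fun x ε => weights_nonneg (htt_le x) ε
  have hW1 : ∀ t : Fin P.d → ℕ, ∑ ε : Fin P.d → Bool, W t ε = 1 := fun t => sum_weights_eq_one P.L t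
  refine ⟨fun x => E x * u₀ x, fun y => ?_, fun b hbS => ?_⟩
  · -- ROOT: `Φ (emb y) = 0`
    have ht0 : ∀ k, tt (emb y) k = 0 := fun k => val_emb_sub_half_mod hj y k
    have hz0 : z0 (emb y) = y := blockOf_emb_sub_half hj y
    have hΦ0 : Φ (emb y) = 0 := by
      show -∑ ε : Fin P.d → Bool, W (tt (emb y)) ε • Λ (emb y) ε = 0
      rw [neg_eq_zero]
      refine Finset.sum_eq_zero fun ε _ => ?_
      by_cases hε : ε = fun _ => false
      · subst hε
        have : Λ (emb y) (fun _ => false) = 0 := by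
          show gl (Up (blockOf (emb y)) (cor (z0 (emb y)) (fun _ => false))) = 0
          rw [Site.blockOf_emb hj, hz0]
          have hc : cor y (fun _ : Fin P.d => false) = y := corner_false y
          rw [hc]
          show gl ((κ y y)⁻¹ * κ y y) = 0
          rw [inv_mul_cancel]; exact glog_one
        rw [this, smul_zero]
      · obtain ⟨k, hk⟩ : ∃ k, ε k = true := by
          by_contra hall
          push Not at hall
          exact hε (funext fun k => by simpa using hall k)
        have : W (tt (emb y)) ε = 0 := by
          show ∏ k, (if ε k then ((tt (emb y) k : ℝ) / P.L) else (1 - (tt (emb y) k : ℝ) / P.L)) = 0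
          exact Finset.prod_eq_zero (Finset.mem_univ k) (by rw [if_pos hk, ht0 k]; simp)
        rw [this, zero_smul]
    have hE1 : E (emb y) = 1 := Subtype.ext (by show exp (Φ (emb y)) = ((1 : Matrix.specialUnitaryGroup n ℂ) : Matrix n n ℂ); rw [hΦ0, exp_zero]; rfl)
    show E (emb y) * u₀ (emb y) = h y
    rw [hE1, one_mul, hroot₀]
  · -- THE BOUND
    set x : Site P j := b.src with hx
    set μ : Fin P.d := b.dir with hμ
    have htgt : b.tgt = Site.shift x μ := rfl
    set t : Fin P.d → ℕ := tt x with ht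
    -- the gauge algebra and the matrix form
    have hact : GaugeField.gaugeAct (fun x => E x * u₀ x) V b = E x * GaugeField.gaugeAct u₀ V b * (E b.tgt)⁻¹ := by
      simp only [GaugeField.gaugeAct, mul_inv_rev, mul_assoc, hx]
    rw [hact, FederbushMean.dist1_SU_eq, coe_mul, coe_mul]
    have hEinv : (((E b.tgt)⁻¹ : Matrix.specialUnitaryGroup n ℂ) : Matrix n n ℂ) = exp (-Φ b.tgt) :=
      coe_inv_mk_exp (hskew _) (htr _)
    have hEx : ((E x : Matrix.specialUnitaryGroup n ℂ) : Matrix n n ℂ) = exp (Φ x) := rfl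
    rw [hEinv, hEx]
    -- S0 on this bond
    have hS0 := hb₀ b a ha0 (by rw [← hx]; exact hplaq b hbS) hguard
    rw [← hf] at hS0
    obtain ⟨hS0in, hS0face⟩ := hS0
    -- corner data of the cell of `x`
    set εx : Fin P.d → Bool := fun k => decide (hh + 1 ≤ t k) with hεx
    have hy : blockOf x = cor (z0 x) εx := hblk' x
    have hcell : ∀ (ε₂ : Fin P.d → Bool) (c : PBond P (j + 1)),
        (∀ i, ∃ e : ℤ, -1 ≤ e ∧ e ≤ 1 ∧ c.src i = (z0 x i + (if ε₂ i then 1 else 0)) + ((e : ℤ) : ZMod (P.sitesPerDir (j + 1)))) →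
        (∀ i, ∃ e : ℤ, -1 ≤ e ∧ e ≤ 1 ∧ c.tgt i = (z0 x i + (if ε₂ i then 1 else 0)) + ((e : ℤ) : ZMod (P.sitesPerDir (j + 1)))) →
          dist1 (G c) ≤ X ∧ dist1 (GaugeField.gaugeAct (κ (fun i => z0 x i + (if ε₂ i then 1 else 0))) G c) ≤ w :=
      fun ε₂ c hs ht' => hcoarse (cor (z0 x) ε₂) ⟨blockOf x, hbS, fun i =>
        ⟨_, (corner_offset_bounds εx ε₂ i).1, (corner_offset_bounds εx ε₂ i).2, by rw [hy]; exact corner_offset (z0 x) εx ε₂ i⟩⟩ c hs ht'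
    have hUp : ∀ ε₁ ε : Fin P.d → Bool, dist1 (Up (cor (z0 x) ε₁) (cor (z0 x) ε)) ≤ Y := fun ε₁ ε =>
      dist1_cornerPotential_le G (κ (cor (z0 x) ε₁)) (z0 x) ε₁ ε hX0 hw0 (hcell ε₁)
    have hΛn : ∀ ε₁ ε : Fin P.d → Bool, ‖gl (Up (cor (z0 x) ε₁) (cor (z0 x) ε))‖ ≤ 2 * Y := fun ε₁ ε => by
      have h1 := norm_glog_le_two_mul (Up (cor (z0 x) ε₁) (cor (z0 x) ε))
      have h2 := hUp ε₁ ε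
      exact h1.trans (by linarith)
    -- the interpolant's one-step increment, for any root corner
    have hD : ∀ (ε₁ : Fin P.d → Bool) (ν : Fin P.d),
        ‖(∑ ε : Fin P.d → Bool, W (Function.update t ν (t ν + 1)) ε • gl (Up (cor (z0 x) ε₁) (cor (z0 x) ε))) -
          ∑ ε : Fin P.d → Bool, W t ε • gl (Up (cor (z0 x) ε₁) (cor (z0 x) ε))‖ ≤
          ((X + 2 * w) + 2 * (X + 2 * w) ^ 2 + 4 * (Y + (X + 2 * w)) ^ 2) / P.L := fun ε₁ ν =>
      norm_interp_succ_sub_interp_le hL0 (htt_le x) ν (fun ε => gl (Up (cor (z0 x) ε₁) (cor (z0 x) ε)))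
        (fun ε hε => norm_glog_corner_edge_sub_le G (κ (cor (z0 x) ε₁)) (z0 x) ε₁ ε ν hε hX0 hw0 hsmall (hcell ε₁))
    -- size of any interpolant of corner data
    have hIn : ∀ (ε₁ : Fin P.d → Bool) (t' : Fin P.d → ℕ), (∀ k, t' k ≤ P.L) →
        ‖∑ ε : Fin P.d → Bool, W t' ε • gl (Up (cor (z0 x) ε₁) (cor (z0 x) ε))‖ ≤ 2 * Y := fun ε₁ t' ht' =>
      norm_sum_smul_le_of_weights _ _ (fun ε _ => weights_nonneg ht' ε) (hW1 t') _ (fun ε _ => hΛn ε₁ ε)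
    have hΦx : Φ x = -∑ ε : Fin P.d → Bool, W t ε • gl (Up (cor (z0 x) εx) (cor (z0 x) ε)) := by
      show -∑ ε : Fin P.d → Bool, W (tt x) ε • gl (Up (blockOf x) (cor (z0 x) ε)) = _
      rw [hy]
    have hΦxn : ‖Φ x‖ ≤ 2 * Y := by rw [hΦx, norm_neg]; exact hIn εx t (htt_le x)
    -- the fine step in cell coordinates
    have hs' : sft b.tgt = Site.shift (sft x) μ := by rw [htgt]; exact sub_const_shift x μ _
    have hr : t μ < P.L := htt_lt x μ
    -- three cases
    rcases (show (t μ + 1 < P.L ∧ t μ ≠ hh) ∨ t μ + 1 = P.L ∨ t μ = hh by omega) with ⟨hA1, hA2⟩ | hB | hC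
    · -- CASE A: interior bond, same cell
      obtain ⟨hz, htμ⟩ := cell_shift_of_lt hj (sft x) μ hA1
      have hz0' : z0 b.tgt = z0 x := by show blockOf (sft b.tgt) = blockOf (sft x); rw [hs', hz]
      have htt' : tt b.tgt = Function.update t μ (t μ + 1) := by
        funext k
        by_cases hk : k = μ
        · rw [hk, Function.update_self]; show (sft b.tgt μ).val % P.L = _; rw [hs', htμ]
        · rw [Function.update_of_ne hk]; show (sft b.tgt k).val % P.L = (sft x k).val % P.L; rw [hs', shift_apply_of_ne _ hk]
      have hblk_eq : blockOf b.tgt = blockOf x := by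
        funext k
        rw [hblk b.tgt k, hblk x k, hz0', htt']
        by_cases hk : k = μ
        · rw [hk, Function.update_self]
          have h5 : tt x μ = t μ := by rw [ht]
          have : (hh + 1 ≤ t μ + 1) ↔ (hh + 1 ≤ tt x μ) := by rw [h5]; omega
          simp only [this]
        · rw [Function.update_of_ne hk]
      have hΦt : Φ b.tgt = -∑ ε : Fin P.d → Bool, W (Function.update t μ (t μ + 1)) ε • gl (Up (cor (z0 x) εx) (cor (z0 x) ε)) := by
        show -∑ ε : Fin P.d → Bool, W (tt b.tgt) ε • gl (Up (blockOf b.tgt) (cor (z0 b.tgt) ε)) = _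
        rw [htt', hblk_eq, hz0', hy]
      have hΦtn : ‖Φ b.tgt‖ ≤ 2 * Y := by
        rw [hΦt, norm_neg]
        refine hIn εx _ fun k => ?_
        by_cases hk : k = μ
        · rw [hk, Function.update_self]; omega
        · rw [Function.update_of_ne hk]; exact htt_le x k
      have hdiff : ‖Φ x - Φ b.tgt‖ ≤ ((X + 2 * w) + 2 * (X + 2 * w) ^ 2 + 4 * (Y + (X + 2 * w)) ^ 2) / P.L := by
        rw [hΦx, hΦt]
        have e : (-∑ ε : Fin P.d → Bool, W t ε • gl (Up (cor (z0 x) εx) (cor (z0 x) ε))) -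
            -∑ ε : Fin P.d → Bool, W (Function.update t μ (t μ + 1)) ε • gl (Up (cor (z0 x) εx) (cor (z0 x) ε)) =
            (∑ ε : Fin P.d → Bool, W (Function.update t μ (t μ + 1)) ε • gl (Up (cor (z0 x) εx) (cor (z0 x) ε))) -
              ∑ ε : Fin P.d → Bool, W t ε • gl (Up (cor (z0 x) εx) (cor (z0 x) ε)) := by abel
        rw [e]; exact hD εx μ
      have hF : ‖((GaugeField.gaugeAct u₀ V b : Matrix.specialUnitaryGroup n ℂ) : Matrix n n ℂ) - 1‖ ≤ f := by
        rw [← FederbushMean.dist1_SU_eq]; exact hS0in (by rw [hblk_eq, hx])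
      have key := norm_exp_mul_mul_exp_neg_sub_one_le (hskew x) (hskew b.tgt) hΦxn hΦtn hα hF
      refine key.trans ?_
      exact arith_interior hX0 hw0 hd1 hLr hf0 hY hdiff
    · -- CASE B: interior bond into the next cell
      obtain ⟨hz, htμ⟩ := cell_shift_of_eq hj (sft x) μ hB
      have hz0' : z0 b.tgt = Site.shift (z0 x) μ := by show blockOf (sft b.tgt) = Site.shift (blockOf (sft x)) μ; rw [hs', hz]
      have htt' : tt b.tgt = Function.update t μ 0 := by
        funext k
        by_cases hk : k = μ
        · rw [hk, Function.update_self]; show (sft b.tgt μ).val % P.L = 0; rw [hs', htμ]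
        · rw [Function.update_of_ne hk]; show (sft b.tgt k).val % P.L = (sft x k).val % P.L; rw [hs', shift_apply_of_ne _ hk]
      have hhL : hh + 1 ≤ P.L - 1 := by omega
      have hblk_eq : blockOf b.tgt = blockOf x := by
        funext k
        rw [hblk b.tgt k, hblk x k, hz0', htt']
        by_cases hk : k = μ
        · rw [hk, Function.update_self, shift_apply_self]
          have h1 : ¬ (hh + 1 ≤ 0) := by omega
          have h2 : hh + 1 ≤ t μ := by omega
          rw [if_neg h1, if_pos h2, add_zero]
        · rw [Function.update_of_ne hk, shift_apply_of_ne _ hk]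
      have hΦt : Φ b.tgt = -∑ ε : Fin P.d → Bool, W (Function.update t μ (t μ + 1)) ε • gl (Up (cor (z0 x) εx) (cor (z0 x) ε)) := by
        show -∑ ε : Fin P.d → Bool, W (tt b.tgt) ε • gl (Up (blockOf b.tgt) (cor (z0 b.tgt) ε)) = _
        rw [htt', hblk_eq, hz0', hy, hB]
        congr 1
        refine interp_face_shift P.L hL0 t μ (fun ε => gl (Up (cor (z0 x) εx) (cor (z0 x) ε)))
          (fun ε' => gl (Up (cor (z0 x) εx) (cor (Site.shift (z0 x) μ) ε'))) fun ε' hε' => ?_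
        show gl (Up (cor (z0 x) εx) (cor (Site.shift (z0 x) μ) ε')) = gl (Up (cor (z0 x) εx) (cor (z0 x) (Function.update ε' μ true)))
        have : cor (Site.shift (z0 x) μ) ε' = cor (z0 x) (Function.update ε' μ true) := corner_of_shift (z0 x) ε' μ hε'
        rw [this]
      have hΦtn : ‖Φ b.tgt‖ ≤ 2 * Y := by
        rw [hΦt, norm_neg]
        refine hIn εx _ fun k => ?_
        by_cases hk : k = μ
        · rw [hk, Function.update_self]; omega
        · rw [Function.update_of_ne hk]; exact htt_le x k
      have hdiff : ‖Φ x - Φ b.tgt‖ ≤ ((X + 2 * w) + 2 * (X + 2 * w) ^ 2 + 4 * (Y + (X + 2 * w)) ^ 2) / P.L := by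
        rw [hΦx, hΦt]
        have e : (-∑ ε : Fin P.d → Bool, W t ε • gl (Up (cor (z0 x) εx) (cor (z0 x) ε))) -
            -∑ ε : Fin P.d → Bool, W (Function.update t μ (t μ + 1)) ε • gl (Up (cor (z0 x) εx) (cor (z0 x) ε)) =
            (∑ ε : Fin P.d → Bool, W (Function.update t μ (t μ + 1)) ε • gl (Up (cor (z0 x) εx) (cor (z0 x) ε))) -
              ∑ ε : Fin P.d → Bool, W t ε • gl (Up (cor (z0 x) εx) (cor (z0 x) ε)) := by abel
        rw [e]; exact hD εx μ
      have hF : ‖((GaugeField.gaugeAct u₀ V b : Matrix.specialUnitaryGroup n ℂ) : Matrix n n ℂ) - 1‖ ≤ f := by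
        rw [← FederbushMean.dist1_SU_eq]; exact hS0in (by rw [hblk_eq, hx])
      have key := norm_exp_mul_mul_exp_neg_sub_one_le (hskew x) (hskew b.tgt) hΦxn hΦtn hα hF
      refine key.trans ?_
      exact arith_interior hX0 hw0 hd1 hLr hf0 hY hdiff
    · -- CASE C: the face bond
      have hC1 : (sft x μ).val % P.L + 1 < P.L := by show t μ + 1 < P.L; omega
      obtain ⟨hz, htμ⟩ := cell_shift_of_lt hj (sft x) μ hC1
      have hz0' : z0 b.tgt = z0 x := by show blockOf (sft b.tgt) = blockOf (sft x); rw [hs', hz]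
      have htt' : tt b.tgt = Function.update t μ (t μ + 1) := by
        funext k
        by_cases hk : k = μ
        · rw [hk, Function.update_self]; show (sft b.tgt μ).val % P.L = _; rw [hs', htμ]
        · rw [Function.update_of_ne hk]; show (sft b.tgt k).val % P.L = (sft x k).val % P.L; rw [hs', shift_apply_of_ne _ hk]
      have hεxμ : εx μ = false := by rw [hεx]; simp only [decide_eq_false_iff_not]; omega
      -- the two roots
      set y : Site P (j + 1) := cor (z0 x) εx with hydef
      set y' : Site P (j + 1) := cor (z0 x) (Function.update εx μ true) with hy'def
      have hyshift : Site.shift y μ = y' := shift_corner (z0 x) εx μ hεxμ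
      have hblk_t : blockOf b.tgt = y' := by
        rw [hblk' b.tgt, hz0', htt']
        show cor (z0 x) (fun k => decide (hh + 1 ≤ Function.update t μ (t μ + 1) k)) = cor (z0 x) (Function.update εx μ true)
        congr 1
        funext k
        by_cases hk : k = μ
        · rw [hk, Function.update_self, Function.update_self]; simp only [decide_eq_true_eq]; omega
        · rw [Function.update_of_ne hk, Function.update_of_ne hk]
      have hface : blockOf b.tgt = Site.shift (blockOf b.src) b.dir := by rw [hblk_t, ← hx, hy, ← hμ, hyshift]
      have hF7 := hS0face hface
      rw [← hx, ← hμ, hy] at hF7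
      -- the root edge `⟨y, μ⟩`
      have hys : ∀ i, ∃ e : ℤ, -1 ≤ e ∧ e ≤ 1 ∧ (⟨y, μ⟩ : PBond P (j + 1)).src i =
          (z0 x i + (if εx i then 1 else 0)) + ((e : ℤ) : ZMod (P.sitesPerDir (j + 1))) := fun i => ⟨0, by norm_num, by norm_num, by simp [hydef, cor]⟩
      have hyt : ∀ i, ∃ e : ℤ, -1 ≤ e ∧ e ≤ 1 ∧ (⟨y, μ⟩ : PBond P (j + 1)).tgt i =
          (z0 x i + (if εx i then 1 else 0)) + ((e : ℤ) : ZMod (P.sitesPerDir (j + 1))) := fun i =>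
        ⟨_, (corner_offset_bounds εx (Function.update εx μ true) i).1, (corner_offset_bounds εx (Function.update εx μ true) i).2, by
          rw [PBond.tgt]; change Site.shift y μ i = _; rw [hyshift]; exact corner_offset (z0 x) εx _ i⟩
      obtain ⟨hXe, hwe⟩ := hcell εx ⟨y, μ⟩ hys hyt
      obtain ⟨Mc, hMc, hGeq, hU₀⟩ := exists_rootEdge_factor G (κ y) y μ hXe hwe
      rw [hyshift] at hGeq hU₀
      set U₀ : Matrix.specialUnitaryGroup n ℂ := (κ y y)⁻¹ * κ y y' with hU₀def
      -- the factorisation of the link: `(V^{u₀}) b = Fm · U₀`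
      set Fm : Matrix.specialUnitaryGroup n ℂ := (GaugeField.gaugeAct u₀ V b * (G ⟨y, μ⟩)⁻¹) * Mc⁻¹ with hFm_def
      have hFm : dist1 Fm ≤ 7 * f + w := by
        rw [hFm_def]; refine (GaugeGroup.dist1_mul_le _ _).trans ?_; rw [GaugeGroup.dist1_inv]; linarith
      have hlink : GaugeField.gaugeAct u₀ V b = Fm * U₀ := by
        rw [hFm_def, hGeq]; group
      have hU₀g : dist1 U₀ < 1 / 3 := by linarith
      have hU₀exp : (U₀ : Matrix n n ℂ) = exp (gl U₀) := (exp_glog hU₀g).symm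
      rw [hlink, coe_mul, hU₀exp]
      have e3 : exp (Φ x) * ((Fm : Matrix n n ℂ) * exp (gl U₀)) * exp (-Φ b.tgt) =
          exp (Φ x) * (Fm : Matrix n n ℂ) * exp (gl U₀) * exp (-Φ b.tgt) := by noncomm_ring
      rw [e3]
      have hFm' : ‖(Fm : Matrix n n ℂ) - 1‖ ≤ 7 * f + w := by rw [← FederbushMean.dist1_SU_eq]; exact hFm
      have hΛ₀n : ‖gl U₀‖ ≤ 2 * Y := by
        have h1 := norm_glog_le_two_mul U₀
        exact h1.trans (by linarith)
      -- `Φ b.tgt` is the interpolant at `t + e_μ` of the data rooted at `y'`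
      have hΦt : Φ b.tgt = -∑ ε : Fin P.d → Bool, W (Function.update t μ (t μ + 1)) ε •
          gl (Up y' (cor (z0 x) ε)) := by
        show -∑ ε : Fin P.d → Bool, W (tt b.tgt) ε • gl (Up (blockOf b.tgt) (cor (z0 b.tgt) ε)) = _
        rw [htt', hblk_t, hz0']
      have hΦtn : ‖Φ b.tgt‖ ≤ 2 * Y := by
        rw [hΦt, norm_neg]
        refine hIn (Function.update εx μ true) _ fun k => ?_
        by_cases hk : k = μ
        · rw [hk, Function.update_self]; omega
        · rw [Function.update_of_ne hk]; exact htt_le x k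
      have hΦtn' : ‖-Φ b.tgt‖ ≤ 2 * Y := by rw [norm_neg]; exact hΦtn
      -- the root change: `Λ_y(ε) = gl U₀ + Λ_{y'}(ε) + R ε`, `‖R ε‖ ≤ ρ`
      set ρ : ℝ := 2 * (2 * P.d * w) + 4 * ((X + w) + ((2 * P.d * w) + P.d * (X + w) + (2 * P.d * w) * (P.d * (X + w)))) ^ 2 +
        4 * ((2 * P.d * w) + P.d * (X + w)) ^ 2 with hρ
      have hR : ∀ ε : Fin P.d → Bool, ‖gl (Up y (cor (z0 x) ε)) - gl U₀ - gl (Up y' (cor (z0 x) ε))‖ ≤ ρ := fun ε => by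
        have h3 := norm_glog_corner_root_change_le G κ (z0 x) εx ε μ hεxμ hX0 hw0 hsmall hcell
        exact h3
      -- the first-order cancellation
      have hsum : Φ x + gl U₀ + -Φ b.tgt =
          ((∑ ε : Fin P.d → Bool, W (Function.update t μ (t μ + 1)) ε • gl (Up y' (cor (z0 x) ε))) -
              ∑ ε : Fin P.d → Bool, W t ε • gl (Up y' (cor (z0 x) ε))) -
            ∑ ε : Fin P.d → Bool, W t ε • (gl (Up y (cor (z0 x) ε)) - gl U₀ - gl (Up y' (cor (z0 x) ε))) := by
        rw [hΦx, hΦt]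
        have hsplit : ∑ ε : Fin P.d → Bool, W t ε • (gl (Up y (cor (z0 x) ε)) - gl U₀ - gl (Up y' (cor (z0 x) ε))) =
            ∑ ε : Fin P.d → Bool, W t ε • gl (Up y (cor (z0 x) ε)) - (∑ ε : Fin P.d → Bool, W t ε) • gl U₀ -
              ∑ ε : Fin P.d → Bool, W t ε • gl (Up y' (cor (z0 x) ε)) := by
          rw [Finset.sum_smul, ← Finset.sum_sub_distrib, ← Finset.sum_sub_distrib]
          refine Finset.sum_congr rfl fun ε _ => ?_
          rw [smul_sub, smul_sub]
        rw [hsplit, hW1 t, one_smul]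
        abel
      have hfirst : ‖Φ x + gl U₀ + -Φ b.tgt‖ ≤ ((X + 2 * w) + 2 * (X + 2 * w) ^ 2 + 4 * (Y + (X + 2 * w)) ^ 2) / P.L + ρ := by
        rw [hsum]
        refine (norm_sub_le _ _).trans (add_le_add (hD _ μ) ?_)
        exact norm_sum_smul_le_of_weights _ _ (fun ε _ => hWnn x ε) (hW1 t) _ (fun ε _ => hR ε)
      have key := norm_exp_mul_mul_exp_mul_exp_sub_one_le (hskew x) (hgl_skew U₀) (star_neg_of_skew (hskew b.tgt)) hΦxn hΛ₀n hΦtn'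
        hα hFm'
      refine key.trans ?_
      exact arith_face f hX0 hw0 hd1 hLr hsmall hY hfirst

end Main

end Summit.QuantumFields.YangMills.Theorems.PoincareLipschitzHierAlignSharpStep

end
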